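/-
Copyright (c) 2026. All rights reserved.
Released under Apache 2.0 license as described in the file LICENSE.
-/
import Literature.AlgebraicGeometry.ComplexMultiplication.HyperellipticJacobianCMCurveTimesSimpleFourfoldDivisorGenerated
import HarnessLib

/-!
# `k = ℚ(√−2)` acts on the CM type of `Y_{40}` with multiplicities `(1, 3)`: `E' × Y_{40} ⊂ J_{40}` is Moonen–Zarhin's case (g), Case 2

Family `hodge`, cell `pub-hodgecm2` (COR-CM), KEPT Literature lane `lit-deligne-3` (generation 55, file F47; sequel of F46
`HyperellipticJacobianCMCurveTimesSimpleFourfoldDivisorGenerated` §4 (`√−2 ∈ L_{40}`)).  THEOREMS ONLY: no definition, no named fact, no `sorry`,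
no instance; D-0026 net debt `0`.  Nothing here asserts the algebraicity of any class; HC_CM is NOT proved.

THE POINT.  Moonen–Zarhin, Math. Ann. **315** (1999) §5 [corpus: paper:arxiv-math_9901113 p. 10]: for `X ∼ E × Y`, `E` a CM elliptic curve with
`k = End⁰(E)`, `Y` a simple fourfold of type IV with an embedding `k ↪ End⁰(Y)`, «Case 1: Suppose that `k` acts on `T_{Y,0}` with multiplicities
`(2,2)` … Hence `Hg(X) = Hg(E) × Hg(Y)`.  Case 2: Suppose that `k` acts on `T_{Y,0}` with multiplicities `(1,3)`. (By [], Proposition 14 this is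
the only other case that occurs.) Rather than looking at `E × Y`, let us look at `Z := E² × Y` … the corresponding space of Weil classes
`W_k ⊂ H⁶(Z, ℚ)` consists of Hodge classes».  Inside `J_{40}`: `E'` has CM by `k = ℚ(ζ_8 − ζ_8^{−1}) = ℚ(√−2)`, `Y_{40}` has CM type `(L_{40}; Ψ_{40})`
with `Ψ^K = Φ_{40}` (the lower-half type of `ℚ(ζ_{40})`, `X_{40} ∼ Y_{40}²`), and `w = ζ_{40}^5 − ζ_{40}^{−5} ∈ L_{40}` is a square root of `−2`
(F46 §4).  THIS file computes the multiplicities: on `Φ_{40}` (8 embeddings, `e < 20`) the embeddings sending `w ↦ σ₇(w)` are `e ∈ {7, 13}` and those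
sending `w ↦ −σ₇(w)` are `e ∈ {1, 3, 9, 11, 17, 19}` — multiplicities `(2, 6)`; through the 2-to-1 restriction (`[ℚ(ζ_{40}) : L_{40}] = 2`) the
type `Ψ_{40}` of `Y_{40}` has multiplicities **`(1, 3)`** for `k = ℚ(w)`.  So `E' × Y_{40}` is Case 2 — consistent with F42 §4 (not stably
nondegenerate), F43 (the `(3,3)`-class on `E'² × Y_{40} = Z`), F46 (`B•(E' ⊕ Y_{40}) = D•`).

THE MECHANISM.  `σ(w) = μ^{5e} − μ^{−5e}` (`μ = e^{2πi/40}`, `e = e(σ)`); in a field `a − a^{−1} = b − b^{−1} ⟺ a = b ∨ ab = −1` (§1); `μ^{20} = −1`;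
so `σ(w) = σ'(w) ⟺ e ≡ e' (mod 8) ∨ e + e' ≡ 4 (mod 8)` (§2 `apply_zetaOf_pow_five_sub_inv_eq_iff`); the counts are residue counts
(`σ ↦ e(σ)` is a bijection onto the units, Washington Thm. 2.5) closed by `decide`; `w² = −2` makes `σ(w) ∈ {±σ₀(w)}`.

WHAT IS PROVED.
* §2 `zetaOf_pow_five_sub_inv_sq` (`w² = −2`), **`apply_zetaOf_pow_five_sub_inv_eq_iff`**, **`exists_multiplicities_two_six_of_level_forty`**
  (`∃ σ₀ ∈ Φ_{40}`, `e(σ₀) = 7`: `#{σ ∈ Φ : σ w = σ₀ w} = 2`, `#{σ ∈ Φ : σ w = −σ₀ w} = 6`).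
* §3 **`exists_multiplicities_one_three_subPair_of_level_forty`** — for an index-`2` sub-pair `(L; Ψ)` with `Ψ^K = Φ_{40}` and `w ∈ L`:
  `∃ ρ₀ ∈ Ψ`: `#{ρ ∈ Ψ : ρ w = ρ₀ w} = 1`, `#{ρ ∈ Ψ : ρ w = −ρ₀ w} = 3`, `ρ₀(w)² = −2`.

HONEST.  CM-type level only: `k ↪ End⁰(Y_{40})` as an algebra embedding and the action on `T_{Y,0}` itself are NOT typed (the tree's realisation
`θB : L → End(H¹)` would carry it); `Hg` is not typed.  No numerics beyond `decide`; no algebraicity claim.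

## References
* [MoonenZarhin1999LowDim] B. Moonen, Yu. Zarhin, Math. Ann. 315 (1999) 711–733: §5 Case 1 ∕ Case 2, Thm. 0.2 (3) [corpus: paper:arxiv-math_9901113 p. 10].
  [cite: MoonenZarhin1999LowDim, §5 Case 2 and Thm. 0.2 (3)]
* [GalleseGoodsonLombardo2024] Gallese–Goodson–Lombardo, §3 Thm. 3.0 (5), §3.2 Lemma 11–12. [cite: GalleseGoodsonLombardo2024, §3 Thm. 3.0 (5) and §3.2 Lemma 11]
* [Shimura1998] G. Shimura (1998), §6.2 Thm. 3, §8.1 Prop. 14. [cite: Shimura1998, §6.2 Thm. 3]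
* [Washington1997] L. C. Washington, *Introduction to Cyclotomic Fields*, Thm. 2.5. [cite: Washington1997, Thm. 2.5]
-/

open CategoryTheory CategoryTheory.Limits NumberField Module

namespace Literature.AlgebraicGeometry.ComplexMultiplication

open Literature.AlgebraicGeometry.Motives
open Literature.AlgebraicGeometry.Motives.AbelianVariety
open Literature.AlgebraicGeometry.HodgeTheory (complexBetti IsRationalClass IsOfHodgeType IsStablyNondegenerate
  IsDivisorGenerated HodgeConjectureFor)
open Literature.NumberTheory.ComplexMultiplication

namespace HyperellipticJacobian

open Literature.AlgebraicGeometry.Pohlmann1968 Literature.AlgebraicGeometry.Pohlmann1968.Cyclotomic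
open Literature.AlgebraicGeometry.Pohlmann1968.CMAlgebra

/-! ## §1 `a − a^{−1} = b − b^{−1} ⟺ a = b ∨ ab = −1` -/

section Algebra

/-- In a field, `a − a^{−1} = b − b^{−1}` iff `a = b` or `ab = −1` (`(a − b)(ab + 1) = 0`). [folklore] -/
private theorem sub_inv_eq_sub_inv_iff {F : Type*} [Field F] {a b : F} (ha : a ≠ 0) (hb : b ≠ 0) :
    a - a⁻¹ = b - b⁻¹ ↔ a = b ∨ a * b = -1 := by
  have e1 : a⁻¹ * (a * b) = b := by rw [← mul_assoc, inv_mul_cancel₀ ha, one_mul]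
  have e2 : b⁻¹ * (a * b) = a := by rw [mul_comm a b, ← mul_assoc, inv_mul_cancel₀ hb, one_mul]
  constructor
  · intro h
    have h0 : (a - b) * (a * b + 1) = 0 := by
      calc (a - b) * (a * b + 1) = (a - a⁻¹) * (a * b) - (b - b⁻¹) * (a * b) := by
            rw [sub_mul a a⁻¹, sub_mul b b⁻¹, e1, e2]; ring
        _ = 0 := by rw [h, sub_self]
    rcases mul_eq_zero.1 h0 with h1 | h1
    · exact Or.inl (sub_eq_zero.1 h1)
    · exact Or.inr (eq_neg_of_add_eq_zero_left h1)
  · rintro (rfl | h)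
    · rfl
    · have ha' : a⁻¹ = -b := inv_eq_of_mul_eq_one_right (by rw [mul_neg, h, neg_neg])
      have hb' : b⁻¹ = -a := inv_eq_of_mul_eq_one_right (by rw [mul_neg, mul_comm, h, neg_neg])
      rw [ha', hb']
      ring

end Algebra

/-! ## §2 `ℚ(ζ_{40})`: when do two embeddings agree on `w = ζ^5 − ζ^{−5} = √−2`? -/

section LevelForty

variable {N : ℕ} [NeZero N] {K : Type} [Field K] [NumberField K] [IsCyclotomicExtension {N} ℚ K]

/-- `w = ζ_{40}^5 − ζ_{40}^{−5}` has `w² = −2` (`u = ζ^5`: `u⁴ = −1`, `(u − u^{−1})² = u² − 2 + u^{−2} = −2`). [cite: Washington1997, Ch. 2] -/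
theorem zetaOf_pow_five_sub_inv_sq (hN : N = 40) :
    (zetaOf N K ^ 5 - (zetaOf N K ^ 5)⁻¹) ^ 2 = -2 := by
  subst hN
  have hprim : IsPrimitiveRoot (zetaOf 40 K) 40 := IsCyclotomicExtension.zeta_spec 40 ℚ K
  have hζ0 : zetaOf 40 K ≠ 0 := hprim.ne_zero (by norm_num)
  have hu0 : zetaOf 40 K ^ 5 ≠ 0 := pow_ne_zero _ hζ0
  have h4 : (zetaOf 40 K ^ 5) ^ 4 = -1 := by
    rw [← pow_mul]
    exact (hprim.pow (by norm_num) (show 40 = 5 * 4 * 2 by rfl)).eq_neg_one_of_two_right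
  have hinv2 : ((zetaOf 40 K ^ 5) ^ 2)⁻¹ = -((zetaOf 40 K ^ 5) ^ 2) := by
    refine inv_eq_of_mul_eq_one_right ?_
    rw [mul_neg, ← pow_add, show 2 + 2 = 4 by rfl, h4, neg_neg]
  rw [sub_sq, mul_assoc, mul_inv_cancel₀ hu0, mul_one, inv_pow, hinv2]
  ring

/-- The residue count: units `v < 20` of `ℤ/40` with `v ≡ 7` or `v + 7 ≡ 4 (mod 8)` — `{7, 13}`. [folklore] -/
private theorem card_units_lower_agree_seven :
    (Finset.univ.filter fun v : ZMod 40 => v.val.Coprime 40 ∧ (2 * v.val < 40 ∧ (v.val % 8 = 7 ∨ (v.val + 7) % 8 = 4))).card = 2 := by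
  decide

/-- The residue count: units `v < 20` of `ℤ/40` with neither `v ≡ 7` nor `v + 7 ≡ 4 (mod 8)` — `{1, 3, 9, 11, 17, 19}`. [folklore] -/
private theorem card_units_lower_disagree_seven :
    (Finset.univ.filter fun v : ZMod 40 => v.val.Coprime 40 ∧ (2 * v.val < 40 ∧ ¬(v.val % 8 = 7 ∨ (v.val + 7) % 8 = 4))).card = 6 := by
  decide

/-- **TWO EMBEDDINGS OF `ℚ(ζ_{40})` AGREE ON `w = ζ^5 − ζ^{−5}` IFF THEIR EXPONENTS SATISFY `e ≡ e' (mod 8)` OR `e + e' ≡ 4 (mod 8)`**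
(`σ(w) = μ^{5e} − μ^{−5e}` with `μ = e^{2πi/40}`; `a − a^{−1} = b − b^{−1} ⟺ a = b ∨ ab = −1`; `μ^{20} = −1`).
[cite: Washington1997, Thm. 2.5] [cite: MoonenZarhin1999LowDim, §5 Case 2] -/
theorem apply_zetaOf_pow_five_sub_inv_eq_iff (hN : N = 40) (σ σ' : K →+* ℂ) :
    σ (zetaOf N K ^ 5 - (zetaOf N K ^ 5)⁻¹) = σ' (zetaOf N K ^ 5 - (zetaOf N K ^ 5)⁻¹) ↔
      ((expOf N K σ).val % 8 = (expOf N K σ').val % 8 ∨ ((expOf N K σ).val + (expOf N K σ').val) % 8 = 4) := by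
  subst hN
  have hμ : IsPrimitiveRoot (rootζ 40) 40 := by
    simpa [rootζ] using Complex.isPrimitiveRoot_exp 40 (by norm_num)
  have hμ0 : rootζ 40 ≠ 0 := hμ.ne_zero (by norm_num)
  have h20 : rootζ 40 ^ 20 = -1 := (hμ.pow (by norm_num) (show 40 = 20 * 2 by rfl)).eq_neg_one_of_two_right
  have hred : ∀ n : ℕ, rootζ 40 ^ n = rootζ 40 ^ (n % 40) := fun n => by
    conv_lhs => rw [← Nat.mod_add_div n 40, pow_add, pow_mul, hμ.pow_eq_one, one_pow, mul_one]
  have hiff : ∀ a b : ℕ, rootζ 40 ^ a = rootζ 40 ^ b ↔ a % 40 = b % 40 := fun a b => by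
    rw [hred a, hred b]
    exact ⟨fun h => hμ.pow_inj (Nat.mod_lt _ (by norm_num)) (Nat.mod_lt _ (by norm_num)) h, fun h => by rw [h]⟩
  rw [map_sub, map_sub, map_inv₀, map_inv₀, map_pow, map_pow, expOf_spec 40 K σ, expOf_spec 40 K σ', ← pow_mul, ← pow_mul,
    sub_inv_eq_sub_inv_iff (pow_ne_zero _ hμ0) (pow_ne_zero _ hμ0), ← pow_add, show (-1 : ℂ) = rootζ 40 ^ 20 from h20.symm,
    hiff, hiff]
  omega

/-- Counting embeddings of `ℚ(ζ_N)` by their exponents (`σ ↦ e(σ)` is a bijection onto the units of `ℤ/N`). [cite: Washington1997, Thm. 2.5] -/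
private theorem card_filter_expOf' (P : ZMod N → Prop) [DecidablePred P] :
    (Finset.univ.filter fun σ : K →+* ℂ => P (expOf N K σ)).card =
      (Finset.univ.filter fun v : ZMod N => v.val.Coprime N ∧ P v).card := by
  rw [← Finset.card_image_of_injective (Finset.univ.filter fun σ : K →+* ℂ => P (expOf N K σ)) (expOf_injective N K)]
  congr 1
  ext v
  simp only [Finset.mem_image, Finset.mem_filter, Finset.mem_univ, true_and]
  constructor
  · rintro ⟨σ, hσ, rfl⟩
    exact ⟨coprime_expOf N K σ, hσ⟩
  · rintro ⟨hv, hP⟩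
    obtain ⟨σ, hσ⟩ := exists_expOf_eq N K v hv
    exact ⟨σ, by rw [hσ]; exact hP, hσ⟩

/-- **MULTIPLICITIES `(2, 6)` OF `k = ℚ(√−2)` ON THE CM TYPE `Φ_{40}` OF `X_{40} ∼ Y_{40}²`.**  With `w = ζ_{40}^5 − ζ_{40}^{−5}` (`w² = −2`) and
the lower-half type `Φ_{40}` (`σ_e ∈ Φ ⟺ e < 20`): there is `σ₀ ∈ Φ` (exponent `7`) such that exactly `2` members of `Φ` agree with `σ₀` on `w`
(exponents `7, 13`) and exactly `6` send `w` to `−σ₀(w)` (exponents `1, 3, 9, 11, 17, 19`) — the imaginary quadratic field `k = ℚ(w)` acts on the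
tangent space of `X_{40}` with multiplicities `(2, 6) = 2·(1, 3)`. [cite: MoonenZarhin1999LowDim, §5 Case 2 and Thm. 0.2 (3)]
[cite: GalleseGoodsonLombardo2024, §3.2 Lemma 11–12] [cite: Washington1997, Thm. 2.5] -/
theorem exists_multiplicities_two_six_of_level_forty (hN : N = 40) (Φ : CMType K)
    (hΦ : ∀ σ : K →+* ℂ, σ ∈ Φ.1 ↔ 2 * (expOf N K σ).val < N) :
    ∃ σ₀ : K →+* ℂ, σ₀ ∈ Φ.1 ∧ (expOf N K σ₀).val = 7 ∧
      {σ | σ ∈ Φ.1 ∧ σ (zetaOf N K ^ 5 - (zetaOf N K ^ 5)⁻¹) = σ₀ (zetaOf N K ^ 5 - (zetaOf N K ^ 5)⁻¹)}.ncard = 2 ∧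
      {σ | σ ∈ Φ.1 ∧ σ (zetaOf N K ^ 5 - (zetaOf N K ^ 5)⁻¹) = -σ₀ (zetaOf N K ^ 5 - (zetaOf N K ^ 5)⁻¹)}.ncard = 6 := by
  classical
  have hsq := zetaOf_pow_five_sub_inv_sq (K := K) hN
  have hagree := apply_zetaOf_pow_five_sub_inv_eq_iff (K := K) hN
  subst hN
  obtain ⟨σ₀, hσ₀⟩ := exists_expOf_eq 40 K (7 : ZMod 40) (by decide)
  have h7 : (expOf 40 K σ₀).val = 7 := by rw [hσ₀]; rfl
  have hmem : σ₀ ∈ Φ.1 := by rw [hΦ, h7]; norm_num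
  set w := zetaOf 40 K ^ 5 - (zetaOf 40 K ^ 5)⁻¹ with hw
  have hw0 : σ₀ w ≠ 0 := by
    intro h
    have := congrArg (· ^ 2) h
    simp only [← map_pow, hsq, map_neg, map_ofNat, ne_eq, OfNat.ofNat_ne_zero, not_false_eq_true, zero_pow] at this
    norm_num at this
  -- `σ w = -σ₀ w ⟺ σ w ≠ σ₀ w`
  have hneg : ∀ σ : K →+* ℂ, σ w = -σ₀ w ↔ ¬σ w = σ₀ w := fun σ => by
    constructor
    · intro h h'
      apply hw0
      have : σ₀ w = -σ₀ w := h'.symm.trans h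
      linear_combination this / 2
    · intro h
      have hsq' : (σ w) ^ 2 = (σ₀ w) ^ 2 := by rw [← map_pow, ← map_pow, hsq, map_neg, map_neg, map_ofNat, map_ofNat]
      rcases eq_or_eq_neg_of_sq_eq_sq _ _ hsq' with h' | h'
      · exact absurd h' h
      · exact h'
  have e1 : {σ | σ ∈ Φ.1 ∧ σ w = σ₀ w} = ↑(Finset.univ.filter fun σ : K →+* ℂ =>
      2 * (expOf 40 K σ).val < 40 ∧ ((expOf 40 K σ).val % 8 = 7 ∨ ((expOf 40 K σ).val + 7) % 8 = 4)) := by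
    ext σ
    rw [Set.mem_setOf_eq, Finset.coe_filter, Set.mem_setOf_eq, hΦ, hagree σ σ₀, h7]
    simp only [Finset.mem_univ, true_and]
  have e2 : {σ | σ ∈ Φ.1 ∧ σ w = -σ₀ w} = ↑(Finset.univ.filter fun σ : K →+* ℂ =>
      2 * (expOf 40 K σ).val < 40 ∧ ¬((expOf 40 K σ).val % 8 = 7 ∨ ((expOf 40 K σ).val + 7) % 8 = 4)) := by
    ext σ
    rw [Set.mem_setOf_eq, Finset.coe_filter, Set.mem_setOf_eq, hΦ, hneg σ, hagree σ σ₀, h7]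
    simp only [Finset.mem_univ, true_and]
  refine ⟨σ₀, hmem, h7, ?_, ?_⟩
  · rw [e1, Set.ncard_coe_finset,
      card_filter_expOf' (K := K) (P := fun v : ZMod 40 => 2 * v.val < 40 ∧ (v.val % 8 = 7 ∨ (v.val + 7) % 8 = 4))]
    exact card_units_lower_agree_seven
  · rw [e2, Set.ncard_coe_finset,
      card_filter_expOf' (K := K) (P := fun v : ZMod 40 => 2 * v.val < 40 ∧ ¬(v.val % 8 = 7 ∨ (v.val + 7) % 8 = 4))]
    exact card_units_lower_disagree_seven

end LevelForty

/-! ## §3 On the simple factor `Y_{40}`: `k = ℚ(√−2) ⊂ L_{40}` acts on the CM type `Ψ_{40}` with multiplicities `(1, 3)` -/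

section SubPair

variable {N : ℕ} [NeZero N] {K : Type} [Field K] [NumberField K] [IsCyclotomicExtension {N} ℚ K]

/-- Counting through a 2-to-1 restriction: `#{σ ∈ Ψ^K : σ(x) = c} = 2 · #{ρ ∈ Ψ : ρ(x) = c}` for `x ∈ L`, `[K : L] = 2`.
[cite: Shimura1998, §6.2 Thm. 3 (proof)] -/
private theorem ncard_eq_two_mul_ncard {L : IntermediateField ℚ K} {Ψ : CMType L} {Φ : CMType K}
    (hind : inducedCMType (algebraMap L K) Ψ = Φ) (hfin : Module.finrank L K = 2) (x : L) (c : ℂ) :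
    {σ : K →+* ℂ | σ ∈ Φ.1 ∧ σ (x : K) = c}.ncard = 2 * {ρ : L →+* ℂ | ρ ∈ Ψ.1 ∧ ρ x = c}.ncard := by
  classical
  have h := card_filter_comp_mem (K := K) (L := L) (Finset.univ.filter fun ρ : L →+* ℂ => ρ ∈ Ψ.1 ∧ ρ x = c)
  rw [hfin] at h
  have e1 : {σ : K →+* ℂ | σ ∈ Φ.1 ∧ σ (x : K) = c} = ↑(Finset.univ.filter fun σ : K →+* ℂ =>
      σ.comp (algebraMap L K) ∈ (Finset.univ.filter fun ρ : L →+* ℂ => ρ ∈ Ψ.1 ∧ ρ x = c)) := by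
    ext σ
    simp only [Set.mem_setOf_eq, Finset.coe_filter, Finset.mem_filter, Finset.mem_univ, true_and, RingHom.coe_comp,
      Function.comp_apply, ← hind, mem_inducedCMType_iff]
    rfl
  have e2 : {ρ : L →+* ℂ | ρ ∈ Ψ.1 ∧ ρ x = c} = ↑(Finset.univ.filter fun ρ : L →+* ℂ => ρ ∈ Ψ.1 ∧ ρ x = c) := by
    ext ρ
    simp only [Set.mem_setOf_eq, Finset.coe_filter, Finset.mem_univ, true_and]
  rw [e1, e2, Set.ncard_coe_finset, Set.ncard_coe_finset, h]

/-- **MULTIPLICITIES `(1, 3)`: MOONEN–ZARHIN'S CASE (g), CASE 2, FOR `Y_{40}`.**  For the index-`2` sub-pair `(L; Ψ)` of `(ℚ(ζ_{40}); Φ_{40})`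
with `Ψ^K = Φ_{40}` and `w = ζ^5 − ζ^{−5} ∈ L` (`w² = −2`; GGL's `L = ℚ(ζ_{40} − ζ_{40}^{−1})`, the CM field of the simple factor `Y_{40}`, F46 §4):
there is `ρ₀ ∈ Ψ` such that exactly ONE member of `Ψ` agrees with `ρ₀` on `w` and exactly THREE send `w` to `−ρ₀(w)` — the imaginary
quadratic field `k = ℚ(w) = ℚ(√−2)` acts on `Lie(Y_{40})` with multiplicities `(1, 3)`: «Case 2: Suppose that `k` acts on `T_{Y,0}` with
multiplicities `(1,3)`» — together with F42 §4 (`E' × Y_{40}` not stably nondegenerate), F43 (the `(3,3)`-class on `E'² × Y_{40}`) and F46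
(`B•(E' ⊕ Y_{40}) = D•`) this identifies `E' × Y_{40} ⊂ J_{40}` as an explicit instance of Moonen–Zarhin's case (g), Case 2.
[cite: MoonenZarhin1999LowDim, §5 Case 2 and Thm. 0.2 (3)] [cite: GalleseGoodsonLombardo2024, §3 Thm. 3.0 (5) and §3.2 Lemma 11]
[cite: Shimura1998, §6.2 Thm. 3] -/
theorem exists_multiplicities_one_three_subPair_of_level_forty (hN : N = 40) (Φ : CMType K)
    (hΦ : ∀ σ : K →+* ℂ, σ ∈ Φ.1 ↔ 2 * (expOf N K σ).val < N)
    {L : IntermediateField ℚ K} {Ψ : CMType L} (hind : inducedCMType (algebraMap L K) Ψ = Φ) (hfin : Module.finrank L K = 2)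
    (hw : zetaOf N K ^ 5 - (zetaOf N K ^ 5)⁻¹ ∈ L) :
    ∃ ρ₀ : L →+* ℂ, ρ₀ ∈ Ψ.1 ∧
      {ρ | ρ ∈ Ψ.1 ∧ ρ ⟨_, hw⟩ = ρ₀ ⟨_, hw⟩}.ncard = 1 ∧ {ρ | ρ ∈ Ψ.1 ∧ ρ ⟨_, hw⟩ = -ρ₀ ⟨_, hw⟩}.ncard = 3 ∧
      (ρ₀ ⟨_, hw⟩) ^ 2 = -2 := by
  obtain ⟨σ₀, hσ₀, -, h2, h6⟩ := exists_multiplicities_two_six_of_level_forty hN Φ hΦ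
  refine ⟨σ₀.comp (algebraMap L K), by rw [← mem_inducedCMType_iff (algebraMap L K), hind]; exact hσ₀, ?_, ?_, ?_⟩
  · have h := ncard_eq_two_mul_ncard hind hfin ⟨_, hw⟩ (σ₀ (zetaOf N K ^ 5 - (zetaOf N K ^ 5)⁻¹))
    rw [h2] at h
    have : (σ₀.comp (algebraMap L K)) ⟨_, hw⟩ = σ₀ (zetaOf N K ^ 5 - (zetaOf N K ^ 5)⁻¹) := rfl
    rw [this]
    omega
  · have h := ncard_eq_two_mul_ncard hind hfin ⟨_, hw⟩ (-σ₀ (zetaOf N K ^ 5 - (zetaOf N K ^ 5)⁻¹))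
    rw [h6] at h
    have : (σ₀.comp (algebraMap L K)) ⟨_, hw⟩ = σ₀ (zetaOf N K ^ 5 - (zetaOf N K ^ 5)⁻¹) := rfl
    rw [this]
    omega
  · show (σ₀ (algebraMap L K ⟨_, hw⟩)) ^ 2 = -2
    rw [← map_pow, show (algebraMap L K ⟨_, hw⟩ : K) = zetaOf N K ^ 5 - (zetaOf N K ^ 5)⁻¹ from rfl,
      zetaOf_pow_five_sub_inv_sq hN, map_neg, map_ofNat]

end SubPair

end HyperellipticJacobian

end Literature.AlgebraicGeometry.ComplexMultiplication
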